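import Mathlib.Topology.MetricSpace.HausdorffDistance
import Mathlib.Analysis.InnerProductSpace.PiL2
import Literature.Algebra.EuclideanLattices.SuccessiveMinima
import Literature.Algebra.EuclideanLattices.IntegerBases
import HarnessLib

-- provenance: harness21/H21/H21/Prelude/Lattice/Problems.lean @ fb9c2df (interim HEAD d8f2665); M5 mechanical rewrite
/-!
# Computational lattice problems: SVP, CVP, SIVP, GapSVP, GapCVP, uSVP, BDD

Trunk: Lattice (prelude), item `LatticeProblems` (concept C4 of the Lattice outline), notion
`lattice_problems_svp_cvp` at the mathematical level (encodings live in a later file).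

We define, for integer lattice instances `I : LatticeInstance` (rows of an integer matrix, see
`Literature.Prelude.Lattice.IntegerBases`) and an *approximation factor* `γ : ℕ → ℝ` evaluated at the
dimension `I.n` (design D3 of the outline):

* `SVP.IsSolution γ I v`, `CVP.IsSolution γ c v`, `SIVP.IsSolution γ I v` : the solution
  relations of the approximate Shortest / Closest / Shortest-Independent Vector Problems;
* `GapSVP.yes γ`, `GapSVP.no γ`, `GapCVP.yes γ`, `GapCVP.no γ` : the YES/NO sets of the promise
  (gap) problems `GapSVP_γ`, `GapCVP_γ`;
* `USVP.Promise γ I`, `USVP.IsSolution I v` : the unique-SVP promise `λ₂ ≥ γ λ₁` and its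
  solutions (shortest vectors);
* `BDD.Promise α c`, `BDD.IsSolution c v` : Bounded Distance Decoding with distance bound
  `dist(t, L) < α λ₁(L)` and its solutions (closest vectors).

Sources: Micciancio–Goldwasser, *Complexity of Lattice Problems* (2002), Ch. 1 (Defs. 1.1–1.5
and §1.2); Peikert, *A decade of lattice cryptography* (2016), §2.2 (Defs. 2.2.1–2.2.5);
Regev, *On lattices, learning with errors, …*, J. ACM (2009), §1.

Mathlib has none of these problems (searched `SVP`, `shortest vector`, `closest vector`,
`GapSVP`); we use Mathlib's `Metric.infDist` for `dist(t, L)`, `LinearIndependent`, `dist`, and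
the H21 notions `minNorm` (`λ₁`), `successiveMinimum` (`λᵢ`), `LatticeInstance.lattice`,
`intVecToEuclidean`.

Design choices:
* Solutions are integer vectors `v : Fin n → ℤ`, read in `ℝⁿ` through `intVecToEuclidean`
  (every vector of an integer lattice is integral, so nothing is lost).
* CVP targets are INTEGER vectors. Micciancio–Goldwasser allow rational bases and targets; this
  is without loss of generality, since scaling the basis and the target simultaneously by a
  common denominator multiplies `dist(t, L(B))` and all distances `dist(t, v)` by the same
  positive constant and hence preserves the `γ`-gap and the solution sets.
* The distance threshold of the gap problems is a rational `d : ℚ`; the YES/NO sets require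
  `0 < d` and a nonsingular basis (full-rank lattice), as in Micciancio–Goldwasser, Def. 1.1.
* `GapSVP.yes γ` and `GapCVP.yes γ` do not depend on `γ`; the argument is kept for uniformity
  of the promise-problem interface (`GapSVP.yes_eq_yes`).
* No condition `γ ≥ 1` is bundled; disjointness of YES/NO is a lemma with hypothesis
  `∀ n, 1 ≤ γ n`.
-/

noncomputable section

open Metric

namespace Literature.Algebra.EuclideanLattices

/-- An instance of the promise problem `GapSVP_γ`: a lattice instance `B` together with a
rational distance threshold `d` (Micciancio–Goldwasser 2002, Ch. 1, Def. 1.4 / §1.2;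
Peikert 2016, Def. 2.2.2). [cite: MicciancioGoldwasser2002, Ch. 1  Def. 1.4 / §1.2] -/
abbrev GapSVPInstance : Type := LatticeInstance × ℚ

/-- An instance of the (approximate) Closest Vector Problem: a lattice instance `B ∈ ℤⁿˣⁿ` and a
target vector `t ∈ ℤⁿ` (Micciancio–Goldwasser 2002, Ch. 1, Def. 1.2 and Def. 1.5; Peikert 2016,
§2.2).  Micciancio–Goldwasser allow rational `B` and `t`; restricting to integer data is without
loss of generality, since multiplying `B` and `t` by a common denominator scales `dist(t, L(B))`
and every `dist(t, v)`, `v ∈ L(B)`, by the same positive factor, which preserves the `γ`-gap and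
the set of (approximate) closest vectors. [cite: MicciancioGoldwasser2002, Ch. 1  Def. 1.2 and Def. 1.5] -/
structure CVPInstance where
  /-- The underlying lattice instance (integer basis matrix). -/
  I : LatticeInstance
  /-- The integer target vector `t ∈ ℤⁿ`. -/
  target : Fin I.n → ℤ

/-- An instance of the promise problem `GapCVP_γ`: a CVP instance `(B, t)` together with a
rational distance threshold `d` (Micciancio–Goldwasser 2002, Ch. 1, Def. 1.5). [cite: MicciancioGoldwasser2002, Ch. 1  Def. 1.5] -/
abbrev GapCVPInstance : Type := CVPInstance × ℚ

namespace CVPInstance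

/-- The target vector of a CVP instance viewed in `ℝⁿ` (Micciancio–Goldwasser 2002, Ch. 1,
Def. 1.2). [cite: MicciancioGoldwasser2002, Ch. 1  Def. 1.2] -/
abbrev targetE (c : CVPInstance) : EuclideanSpace ℝ (Fin c.I.n) :=
  intVecToEuclidean c.I.n c.target

end CVPInstance

/-! ### Search problems -/

namespace SVP

/-- `v ∈ ℤⁿ` solves the approximate Shortest Vector Problem `SVP_γ` on the instance `B`:
`v` is a nonzero vector of `L(B)` with `‖v‖ ≤ γ(n) · λ₁(L(B))` (Micciancio–Goldwasser 2002,
Ch. 1, Def. 1.1 (approximation version, §1.2); Peikert 2016, Def. 2.2.1). [cite: MicciancioGoldwasser2002, Ch. 1  Def. 1.1 (approximation version] -/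
def IsSolution (γ : ℕ → ℝ) (I : LatticeInstance) (v : Fin I.n → ℤ) : Prop :=
  v ≠ 0 ∧ intVecToEuclidean I.n v ∈ I.lattice ∧
    ‖intVecToEuclidean I.n v‖ ≤ γ I.n * minNorm I.lattice

end SVP

namespace CVP

/-- `v ∈ ℤⁿ` solves the approximate Closest Vector Problem `CVP_γ` on the instance `(B, t)`:
`v ∈ L(B)` and `‖v - t‖ ≤ γ(n) · dist(t, L(B))` (Micciancio–Goldwasser 2002, Ch. 1, Def. 1.2
(approximation version, §1.2); Peikert 2016, §2.2). [cite: MicciancioGoldwasser2002, Ch. 1  Def. 1.2 (approximation version] -/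
def IsSolution (γ : ℕ → ℝ) (c : CVPInstance) (v : Fin c.I.n → ℤ) : Prop :=
  intVecToEuclidean c.I.n v ∈ c.I.lattice ∧
    dist (intVecToEuclidean c.I.n v) c.targetE ≤ γ c.I.n * infDist c.targetE c.I.lattice

end CVP

namespace SIVP

/-- `v₁, …, vₙ ∈ ℤⁿ` solve the approximate Shortest Independent Vectors Problem `SIVP_γ` on the
instance `B`: the `vᵢ` are linearly independent vectors of `L(B)` with
`‖vᵢ‖ ≤ γ(n) · λₙ(L(B))` for all `i` (Micciancio–Goldwasser 2002, Ch. 7, Def. 7.1, announced in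
Ch. 1 §1.2; Peikert 2016, Def. 2.2.4). [cite: MicciancioGoldwasser2002, Ch. 7  Def. 7.1  announced in Ch. 1 §1.2] -/
def IsSolution (γ : ℕ → ℝ) (I : LatticeInstance) (v : Fin I.n → Fin I.n → ℤ) : Prop :=
  LinearIndependent ℤ v ∧ (∀ i, intVecToEuclidean I.n (v i) ∈ I.lattice) ∧
    ∀ i, ‖intVecToEuclidean I.n (v i)‖ ≤ γ I.n * successiveMinimum I.lattice I.n

end SIVP

/-! ### Promise (gap) problems -/

namespace GapSVP

/-- YES instances of `GapSVP_γ`: pairs `(B, d)` with `B` nonsingular, `d > 0` and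
`λ₁(L(B)) ≤ d` (Micciancio–Goldwasser 2002, Ch. 1, Def. 1.4 / §1.2 promise version; Peikert 2016,
Def. 2.2.2).  The set does not depend on `γ`; the argument is kept for a uniform interface. [cite: MicciancioGoldwasser2002, Ch. 1  Def. 1.4 / §1.2 promise version] -/
def yes (_γ : ℕ → ℝ) : Set GapSVPInstance :=
  {p | p.1.IsNonsingular ∧ 0 < p.2 ∧ minNorm p.1.lattice ≤ (p.2 : ℝ)}

/-- NO instances of `GapSVP_γ`: pairs `(B, d)` with `B` nonsingular, `d > 0` and
`λ₁(L(B)) > γ(n) · d` (Micciancio–Goldwasser 2002, Ch. 1, §1.2; Peikert 2016, Def. 2.2.2). [cite: MicciancioGoldwasser2002, Ch. 1  §1.2] -/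
def no (γ : ℕ → ℝ) : Set GapSVPInstance :=
  {p | p.1.IsNonsingular ∧ 0 < p.2 ∧ γ p.1.n * (p.2 : ℝ) < minNorm p.1.lattice}

end GapSVP

namespace GapCVP

/-- YES instances of `GapCVP_γ`: triples `((B, t), d)` with `B` nonsingular, `d > 0` and
`dist(t, L(B)) ≤ d` (Micciancio–Goldwasser 2002, Ch. 1, Def. 1.5 / §1.2 promise version).
The set does not depend on `γ`; the argument is kept for a uniform interface. [cite: MicciancioGoldwasser2002, Ch. 1  Def. 1.5 / §1.2 promise version] -/
def yes (_γ : ℕ → ℝ) : Set GapCVPInstance :=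
  {p | p.1.I.IsNonsingular ∧ 0 < p.2 ∧ infDist p.1.targetE p.1.I.lattice ≤ (p.2 : ℝ)}

/-- NO instances of `GapCVP_γ`: triples `((B, t), d)` with `B` nonsingular, `d > 0` and
`dist(t, L(B)) > γ(n) · d` (Micciancio–Goldwasser 2002, Ch. 1, Def. 1.5 / §1.2). [cite: MicciancioGoldwasser2002, Ch. 1  Def. 1.5 / §1.2] -/
def no (γ : ℕ → ℝ) : Set GapCVPInstance :=
  {p | p.1.I.IsNonsingular ∧ 0 < p.2 ∧ γ p.1.I.n * (p.2 : ℝ) < infDist p.1.targetE p.1.I.lattice}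

end GapCVP

namespace USVP

/-- The promise of the unique Shortest Vector Problem `uSVP_γ`: `B` is nonsingular and the
shortest vector is `γ`-unique, `γ(n) · λ₁(L(B)) ≤ λ₂(L(B))` (Regev 2009, §1; Peikert 2016,
§2.2, uSVP; Lyubashevsky–Micciancio 2009). [cite: Regev2009, §1] -/
def Promise (γ : ℕ → ℝ) (I : LatticeInstance) : Prop :=
  I.IsNonsingular ∧ γ I.n * minNorm I.lattice ≤ successiveMinimum I.lattice 2

/-- `v ∈ ℤⁿ` solves `uSVP` on `B`: `v` is a shortest nonzero vector of `L(B)`,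
`‖v‖ = λ₁(L(B))` (Regev 2009, §1; Peikert 2016, §2.2). [cite: Regev2009, §1] -/
def IsSolution (I : LatticeInstance) (v : Fin I.n → ℤ) : Prop :=
  v ≠ 0 ∧ intVecToEuclidean I.n v ∈ I.lattice ∧ ‖intVecToEuclidean I.n v‖ = minNorm I.lattice

end USVP

namespace BDD

/-- The promise of Bounded Distance Decoding `BDD_α`: the target is within distance
`α(n) · λ₁(L(B))` of the lattice, `dist(t, L(B)) < α(n) · λ₁(L(B))` (Peikert 2016, Def. 2.2.5;
Regev 2009, §1; Lyubashevsky–Micciancio 2009). [cite: Peikert2016, Def. 2.2.5] -/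
def Promise (α : ℕ → ℝ) (c : CVPInstance) : Prop :=
  infDist c.targetE c.I.lattice < α c.I.n * minNorm c.I.lattice

/-- `v ∈ ℤⁿ` solves `BDD` on `(B, t)`: `v` is a lattice vector closest to `t`,
`‖v - t‖ = dist(t, L(B))` (unique under the promise with `α ≤ 1/2`; Peikert 2016, Def. 2.2.5). [cite: Peikert2016, Def. 2.2.5] -/
def IsSolution (c : CVPInstance) (v : Fin c.I.n → ℤ) : Prop :=
  intVecToEuclidean c.I.n v ∈ c.I.lattice ∧
    dist (intVecToEuclidean c.I.n v) c.targetE = infDist c.targetE c.I.lattice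

end BDD

/-! ### Basic API -/

/-- For `γ ≥ 1` the YES and NO instances of `GapSVP_γ` are disjoint (so `GapSVP_γ` is a promise
problem; Micciancio–Goldwasser 2002, Ch. 1, §1.2). [cite: MicciancioGoldwasser2002, Ch. 1  §1.2] -/
theorem gapSVP_disjoint {γ : ℕ → ℝ} (hγ : ∀ n, 1 ≤ γ n) :
    Disjoint (GapSVP.yes γ) (GapSVP.no γ) := by
  refine Set.disjoint_left.2 fun p hy hn => ?_
  have h1 : γ p.1.n * (p.2 : ℝ) < (p.2 : ℝ) := hn.2.2.trans_le hy.2.2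
  have h2 : (p.2 : ℝ) ≤ γ p.1.n * (p.2 : ℝ) :=
    le_mul_of_one_le_left (by exact_mod_cast hy.2.1.le) (hγ _)
  exact absurd h1 (not_lt.2 h2)

/-- For `γ ≥ 1` the YES and NO instances of `GapCVP_γ` are disjoint (so `GapCVP_γ` is a promise
problem; Micciancio–Goldwasser 2002, Ch. 1, §1.2). [cite: MicciancioGoldwasser2002, Ch. 1  §1.2] -/
theorem gapCVP_disjoint {γ : ℕ → ℝ} (hγ : ∀ n, 1 ≤ γ n) :
    Disjoint (GapCVP.yes γ) (GapCVP.no γ) := by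
  refine Set.disjoint_left.2 fun p hy hn => ?_
  have h1 : γ p.1.I.n * (p.2 : ℝ) < (p.2 : ℝ) := hn.2.2.trans_le hy.2.2
  have h2 : (p.2 : ℝ) ≤ γ p.1.I.n * (p.2 : ℝ) :=
    le_mul_of_one_le_left (by exact_mod_cast hy.2.1.le) (hγ _)
  exact absurd h1 (not_lt.2 h2)

/-- The YES set of `GapSVP_γ` does not depend on `γ` (Micciancio–Goldwasser 2002, Ch. 1,
§1.2). [cite: MicciancioGoldwasser2002, Ch. 1  §1.2] -/
theorem GapSVP.yes_eq_yes (γ γ' : ℕ → ℝ) : GapSVP.yes γ = GapSVP.yes γ' := rfl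

/-- The YES set of `GapCVP_γ` does not depend on `γ` (Micciancio–Goldwasser 2002, Ch. 1,
§1.2). [cite: MicciancioGoldwasser2002, Ch. 1  §1.2] -/
theorem GapCVP.yes_eq_yes (γ γ' : ℕ → ℝ) : GapCVP.yes γ = GapCVP.yes γ' := rfl

/-- A larger gap is an easier promise: if `γ ≤ γ'` pointwise then every NO instance of
`GapSVP_{γ'}` is a NO instance of `GapSVP_γ` (Micciancio–Goldwasser 2002, Ch. 1, §1.2). [cite: MicciancioGoldwasser2002, Ch. 1  §1.2] -/
theorem GapSVP.no_subset_no_of_le {γ γ' : ℕ → ℝ} (h : γ ≤ γ') :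
    GapSVP.no γ' ⊆ GapSVP.no γ := by
  rintro p ⟨h1, h2, h3⟩
  refine ⟨h1, h2, lt_of_le_of_lt ?_ h3⟩
  exact mul_le_mul_of_nonneg_right (h _) (by exact_mod_cast h2.le)

/-- A larger gap is an easier promise: if `γ ≤ γ'` pointwise then every NO instance of
`GapCVP_{γ'}` is a NO instance of `GapCVP_γ` (Micciancio–Goldwasser 2002, Ch. 1, §1.2). [cite: MicciancioGoldwasser2002, Ch. 1  §1.2] -/
theorem GapCVP.no_subset_no_of_le {γ γ' : ℕ → ℝ} (h : γ ≤ γ') :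
    GapCVP.no γ' ⊆ GapCVP.no γ := by
  rintro p ⟨h1, h2, h3⟩
  refine ⟨h1, h2, lt_of_le_of_lt ?_ h3⟩
  exact mul_le_mul_of_nonneg_right (h _) (by exact_mod_cast h2.le)

/-- Monotonicity of `SVP_γ` in the approximation factor: a `γ`-approximate shortest vector is a
`γ'`-approximate shortest vector for `γ ≤ γ'` (Micciancio–Goldwasser 2002, Ch. 1, §1.2). [cite: MicciancioGoldwasser2002, Ch. 1  §1.2] -/
theorem SVP.isSolution_mono {γ γ' : ℕ → ℝ} (h : γ ≤ γ') {I : LatticeInstance} {v : Fin I.n → ℤ}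
    (hv : SVP.IsSolution γ I v) : SVP.IsSolution γ' I v :=
  ⟨hv.1, hv.2.1, hv.2.2.trans (mul_le_mul_of_nonneg_right (h _) (minNorm_nonneg _))⟩

/-- `SVP_γ` is a total search problem on nonsingular instances of positive dimension when
`γ(n) ≥ 1`: a shortest nonzero vector exists (the minimum distance of a lattice is attained;
Micciancio–Goldwasser 2002, Ch. 1, Thm. 1.1 ff.) and it is integral. [cite: MicciancioGoldwasser2002, Ch. 1  Thm. 1.1 ff] -/
def SVP.exists_isSolution : Prop :=
  ∀ {γ : ℕ → ℝ} {I : LatticeInstance} (hI : I.IsNonsingular) (hn : I.n ≠ 0) (hγ : 1 ≤ γ I.n),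
    ∃ v : Fin I.n → ℤ, SVP.IsSolution γ I v

/-- Any nonzero lattice vector of norm at most `d` witnesses `(B, d) ∈ GapSVP.yes`: in
particular an `SVP_γ` solution of norm `≤ d` does (this is one half of the trivial reduction
from `GapSVP_γ` to `SVP_γ`; Micciancio–Goldwasser 2002, Ch. 1, §1.2). [cite: MicciancioGoldwasser2002, Ch. 1  §1.2] -/
theorem gapSVP_yes_of_svp_isSolution {γ : ℕ → ℝ} {I : LatticeInstance} {v : Fin I.n → ℤ}
    (hI : I.IsNonsingular) (hv : SVP.IsSolution γ I v) {d : ℚ} (hd : 0 < d)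
    (hvd : ‖intVecToEuclidean I.n v‖ ≤ (d : ℝ)) : (I, d) ∈ GapSVP.yes γ := by
  refine ⟨hI, hd, le_trans (csInf_le ?_ ⟨_, ⟨hv.2.1, ?_⟩, rfl⟩) hvd⟩
  · exact ⟨0, by rintro _ ⟨x, -, rfl⟩; exact norm_nonneg x⟩
  · exact fun h0 => hv.1 (intVecToEuclidean_injective _ (by rw [h0, map_zero]))

/-- The other half of the trivial reduction from `GapSVP_γ` to `SVP_γ`: on a NO instance
`(B, d)` every `SVP_γ` solution (indeed every nonzero lattice vector) has norm `> γ(n) · d`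
(Micciancio–Goldwasser 2002, Ch. 1, §1.2). [cite: MicciancioGoldwasser2002, Ch. 1  §1.2] -/
theorem lt_norm_of_mem_gapSVP_no {γ : ℕ → ℝ} {I : LatticeInstance} {v : Fin I.n → ℤ} {d : ℚ}
    (h : (I, d) ∈ GapSVP.no γ) (hv : SVP.IsSolution γ I v) :
    γ I.n * (d : ℝ) < ‖intVecToEuclidean I.n v‖ := by
  refine h.2.2.trans_le (csInf_le ?_ ⟨_, ⟨hv.2.1, ?_⟩, rfl⟩)
  · exact ⟨0, by rintro _ ⟨x, -, rfl⟩; exact norm_nonneg x⟩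
  · exact fun h0 => hv.1 (intVecToEuclidean_injective _ (by rw [h0, map_zero]))

/-- Under the `BDD_α` promise with `α(n) ≤ 1/2`, the solution of `BDD` is unique
(Peikert 2016, Def. 2.2.5 and the remark following it). [cite: Peikert2016, Def. 2.2.5 and the remark following it] -/
def BDD.isSolution_unique : Prop :=
  ∀ {α : ℕ → ℝ} {c : CVPInstance} (hα : α c.I.n ≤ 1 / 2) (hc : BDD.Promise α c) {v w : Fin c.I.n → ℤ} (hv : BDD.IsSolution c v) (hw : BDD.IsSolution c w),
    v = w

end Literature.Algebra.EuclideanLattices
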